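import Summits.BirchSwinnertonDyer.BirchSwinnertonDyer.Theorems.GenusKolyvaginAtTwoTorsionCellSELTwistKernel
import Literature.NumberTheory.EllipticCurves.TwoDescentRankZeroSelmerFullTwoTorsion
import Literature.NumberTheory.EllipticCurves.BSDSelmerSmithRootNumberDensityProofs
import Literature.NumberTheory.EllipticCurves.ModularityVersionApProofs
import HarnessLib

/-!
# SEL (iso-class Selmer pair law), III: a Selmer class of the iso-class twist is torsion times its `Q`-support

Crux R″ `RankOneTwoTorsionResidualAtTwo` (stmt-27478), LINE 49 «full_vertex», SUPPORT stub SEL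
`IsoClassSelmerPairLawAtTwo`, the `C₀ = E₀^{(M)}` half for a general iso-class set (pen bsd-idea-1 memo #3 §3(3b)/§4;
the Greenberg–Wiles/Poitou–Tate count replaced by the evenness theorem of part II and the residue kernel of the base).
Setting: `E/ℚ` with rational `2`-torsion `e₁, e₂, e₃`, rank `0` and `Ш(E)[2] = 0`; `S ∋ 2` a finite set of primes
supporting the conductor and the root differences; `Q` an ISO-CLASS set of FULL-ADMISSIBLE primes `≡ 3 (mod 4)` of even
size, disjoint from `S`; `M = ∏_{q∈Q} q`.

* `twoDescentClass_mul` — additivity of the class-of-a-pair `c(a a', b b') = c(a, b) + c(a', b')`.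
* `twoDescentClass_kernel_mem_selmerGroup` — for `c ∈ Sel⁽²⁾(E^{(M)}/ℚ)` with components `[m_a·∏_{Q_a} i]`,
  `[m_b·∏_{Q_b} i]` (part II: `S`-kernels `m_a, m_b`, EVEN `Q`-supports `Q_a, Q_b`), the STRIPPED class `c_E(m_a, m_b)`
  lies in `Sel⁽²⁾(E/ℚ)`: at `ℓ ∈ S` and at `∞` the numbers `M`, `∏_{Q_a} i`, `∏_{Q_b} i` are local squares (iso-class,
  even size), so the local condition of `E^{(M)}` transfers to `E`; off `S` the components are units at a good place.
* **`components_eq_torsion_mul_support`** — hence (`rank E = 0`, `Ш(E)[2] = 0`, residue kernel at a prime of `Q`):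
  `([a],[b]) = ([t₁·∏_{Q_a} i], [t₂·∏_{Q_b} i])` for one of the four TORSION PAIRS `(t₁,t₂) ∈ {(1,1), (δ₁, e₁−e₂),
  (e₂−e₁, δ₂), (e₃−e₁, e₃−e₂)}` of `E` — every Selmer class of the twist is a torsion class of the base times an even
  `Q`-support class (the explicit basis `tors ⊕ (A × A)` of memo #3 (3b), intersected with the Selmer conditions).

Everything is proved; no LINE 49 statement is restated; BSD is not advanced by this file alone.

## References

* [SilvermanAEC2009] J. H. Silverman, *The Arithmetic of Elliptic Curves*, 2nd ed., Prop. X.1.4, Thm. X.4.2, Prop. X.4.9.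
* [Kane2013SelmerTwists] D. M. Kane, Algebra Number Theory 7 (2013), §2.
* [MazurRubin2010] B. Mazur, K. Rubin, Invent. Math. 181 (2010), Lemma 2.10, Lemma 2.11.
-/

noncomputable section

open scoped Classical

namespace Summit.BirchSwinnertonDyer.BirchSwinnertonDyer.Theorems.GenusKolyvaginAtTwo.TorsionCellSEL

open WeierstrassCurve WeierstrassCurve.Affine WeierstrassCurve.Affine.Point
open Literature.NumberTheory.GaloisRepresentations Literature.NumberTheory.EllipticCurves Field
open Literature.NumberTheory.EllipticCurves.TwoDescentLocal
open Literature.NumberTheory.EllipticCurves.KramerTwoDescent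
open Summit.BirchSwinnertonDyer.BirchSwinnertonDyer.Theorems.GenusKolyvaginAtTwo.TorsionCellD0
open IsDedekindDomain NumberField Rat.HeightOneSpectrum

/-! ## Additivity of the class of a pair -/

section Additivity

variable {K : Type*} [Field K] [CharZero K] (W : WeierstrassCurve K) [W.IsElliptic] {e₁ e₂ e₃ : K}

/-- **`c(a a', b b') = c(a, b) + c(a', b')`**: the class with prescribed components is additive in the pair
(Kummer theory is a homomorphism). [cite: SilvermanAEC2009, Prop. X.1.4] -/
theorem twoDescentClass_mul (h : W.toAffine.SplitTwoTorsion e₁ e₂ e₃) (a a' b b' : Kˣ) :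
    W.twoDescentClass h (a * a') (b * b') = W.twoDescentClass h a b + W.twoDescentClass h a' b' :=
  W.eq_twoDescentClass_of_kummerEquiv_eq h (a * a') (b * b')
    (W.kummerEquiv_twoTorsionCharH1_add h a a' (W.kummerEquiv_twoTorsionCharH1_twoDescentClass h a b)
      (W.kummerEquiv_twoTorsionCharH1_twoDescentClass h a' b'))
    (W.kummerEquiv_twoTorsionCharH1_add h.swap₁₂ b b' (W.kummerEquiv_twoTorsionCharH1_swap_twoDescentClass h a b)
      (W.kummerEquiv_twoTorsionCharH1_swap_twoDescentClass h a' b')) |>.symm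

end Additivity

/-! ## The stripped class is a Selmer class of the base -/

section Strip

variable (E : WeierstrassCurve ℚ) [E.IsElliptic] {e₁ e₂ e₃ : ℚ} (S Q : Finset ℕ)

/-- A sum of bits `∈ {0,1}` over `Q` is the parity of the number of ones. [folklore] -/
private theorem sum_parityBit_eq_card (Q : Finset ℕ) (x : ℚ) :
    ∑ i ∈ Q, parityBit i x = ((Q.filter (fun i => parityBit i x = 1)).card : ZMod 2) := by
  rw [Finset.card_eq_sum_ones, Nat.cast_sum, Finset.sum_filter]
  refine Finset.sum_congr rfl fun i _ => ?_
  have : parityBit i x = 0 ∨ parityBit i x = 1 := by generalize parityBit i x = y; revert y; decide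
  rcases this with h0 | h1
  · rw [h0, if_neg zero_ne_one]
  · rw [h1, if_pos rfl, Nat.cast_one]

/-- **The stripped class of a Selmer class of the iso-class twist is a Selmer class of the base.**  In the setting of the
module docstring, let `c ∈ Sel⁽²⁾(E^{(M)}/ℚ)` have components `[a] = [m_a ∏_{i∈Q_a} i]`, `[b] = [m_b ∏_{i∈Q_b} i]` with
`Q_a, Q_b ⊆ Q` of EVEN size and `m_a, m_b` integers prime to every prime outside `S`.  Then `c_E(m_a, m_b) ∈ Sel⁽²⁾(E/ℚ)`.
[cite: SilvermanAEC2009, Prop. X.1.4, Prop. X.4.9] [cite: MazurRubin2010, Lemma 2.10] [cite: Kane2013SelmerTwists, §2] -/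
theorem twoDescentClass_kernel_mem_selmerGroup (h : E.toAffine.SplitTwoTorsion e₁ e₂ e₃)
    (h2S : 2 ∈ S) (hN : ∀ ℓ : ℕ, ℓ.Prime → ℓ ∉ S → ¬ ℓ ∣ E.conductorNorm ℤ)
    (hQ : ∀ q ∈ Q, q.Prime) (hQS : ∀ q ∈ Q, q ∉ S) (hQ4 : ∀ q ∈ Q, q % 4 = 3) (hk : Even Q.card)
    (hiso8 : ∀ q ∈ Q, ∀ q' ∈ Q, q % 8 = q' % 8)
    (hisoS : ∀ q ∈ Q, ∀ q' ∈ Q, ∀ ℓ ∈ S, (hℓ : ℓ.Prime) → ℓ ≠ 2 → haveI : Fact ℓ.Prime := ⟨hℓ⟩;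
      legendreSym ℓ ((q : ℤ) * q') = 1)
    {d : ℚ} (hd : d = ∏ q ∈ Q, (q : ℚ)) [(E.quadraticTwist d).IsElliptic]
    {c : galH1Torsion (E.quadraticTwist d) 2} (hc : c ∈ selmerGroup (E.quadraticTwist d) 2) (a b : ℚˣ)
    (ha : kummerEquiv ℚ 2 ((E.quadraticTwist d).twoTorsionCharH1 (h.quadraticTwist d) c) =
      Additive.ofMul (QuotientGroup.mk a))
    (hb : kummerEquiv ℚ 2 ((E.quadraticTwist d).twoTorsionCharH1 (h.quadraticTwist d).swap₁₂ c) =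
      Additive.ofMul (QuotientGroup.mk b))
    {Qa Qb : Finset ℕ} (hQa : Qa ⊆ Q) (hQb : Qb ⊆ Q) (hQak : Even Qa.card) (hQbk : Even Qb.card)
    {ma mb : ℤ} (hma0 : (ma : ℚ) ≠ 0) (hmb0 : (mb : ℚ) ≠ 0)
    (hmadiv : ∀ ℓ : ℕ, ℓ.Prime → ℓ ∉ S → ¬ (ℓ : ℤ) ∣ ma) (hmbdiv : ∀ ℓ : ℕ, ℓ.Prime → ℓ ∉ S → ¬ (ℓ : ℤ) ∣ mb)
    (hga : (ma : ℚ) * ∏ i ∈ Qa, (i : ℚ) ≠ 0) (hgb : (mb : ℚ) * ∏ i ∈ Qb, (i : ℚ) ≠ 0)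
    (hmka : (QuotientGroup.mk a : SqUnits ℚ) = QuotientGroup.mk (Units.mk0 _ hga))
    (hmkb : (QuotientGroup.mk b : SqUnits ℚ) = QuotientGroup.mk (Units.mk0 _ hgb)) :
    E.twoDescentClass h (Units.mk0 (ma : ℚ) hma0) (Units.mk0 (mb : ℚ) hmb0) ∈ E.selmerGroup 2 := by
  have h' := h.quadraticTwist d
  have hQ0 : ∀ q ∈ Q, (q : ℚ) ≠ 0 := fun q hq => by exact_mod_cast (hQ q hq).ne_zero
  have hpa0 : ∏ i ∈ Qa, (i : ℚ) ≠ 0 := Finset.prod_ne_zero_iff.mpr fun i hi => hQ0 i (hQa hi)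
  have hpb0 : ∏ i ∈ Qb, (i : ℚ) ≠ 0 := Finset.prod_ne_zero_iff.mpr fun i hi => hQ0 i (hQb hi)
  -- the twist class, rewritten on the representatives `(m_a ∏_{Q_a}, m_b ∏_{Q_b})` and split additively
  have hceq : c = (E.quadraticTwist d).twoDescentClass h' (Units.mk0 (ma : ℚ) hma0) (Units.mk0 (mb : ℚ) hmb0) +
      (E.quadraticTwist d).twoDescentClass h' (Units.mk0 _ hpa0) (Units.mk0 _ hpb0) := by
    rw [(E.quadraticTwist d).eq_twoDescentClass_of_kummerEquiv_eq h' a b ha hb,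
      (E.quadraticTwist d).twoDescentClass_eq_of_mk_eq h' hmka hmkb, ← twoDescentClass_mul]
    congr 1 <;> exact Units.ext (by rw [Units.val_mk0, Units.val_mul, Units.val_mk0, Units.val_mk0])
  rw [mem_selmerGroup_iff]
  refine ⟨fun v => ?_, fun w => ?_⟩
  · by_cases hvS : (primesEquiv v : ℕ) ∈ S
    · -- `ℓ ∈ S`: `d`, `∏_{Q_a}`, `∏_{Q_b}` are local squares; transfer from `E^{(d)}` to `E`
      have hsqd : IsSquare (algebraMap ℚ (v.adicCompletion ℚ) d) := by
        rw [hd]; exact isSquare_prod_adicCompletion_of_isoClass S Q hQ hQS hQ4 hiso8 hisoS (subset_refl Q) hk v hvS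
      have hsqa : IsSquare (algebraMap ℚ (v.adicCompletion ℚ) (∏ i ∈ Qa, (i : ℚ))) :=
        isSquare_prod_adicCompletion_of_isoClass S Q hQ hQS hQ4 hiso8 hisoS hQa hQak v hvS
      have hsqb : IsSquare (algebraMap ℚ (v.adicCompletion ℚ) (∏ i ∈ Qb, (i : ℚ))) :=
        isSquare_prod_adicCompletion_of_isoClass S Q hQ hQS hQ4 hiso8 hisoS hQb hQbk v hvS
      have hloc : c ∈ selmerLocalKer (E.quadraticTwist d) (v.adicCompletion ℚ) 2 := ((mem_selmerGroup_iff _ _ _).mp hc).1 v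
      have hsqpart : (E.quadraticTwist d).twoDescentClass h' (Units.mk0 _ hpa0) (Units.mk0 _ hpb0) ∈
          selmerLocalKer (E.quadraticTwist d) (v.adicCompletion ℚ) 2 :=
        twoDescentClass_mem_selmerLocalKer_of_isSquare (E.quadraticTwist d) h' _
          (charZero_of_injective_algebraMap (algebraMap ℚ _).injective) _ _ hsqa hsqb
      have hker : (E.quadraticTwist d).twoDescentClass h' (Units.mk0 (ma : ℚ) hma0) (Units.mk0 (mb : ℚ) hmb0) ∈
          selmerLocalKer (E.quadraticTwist d) (v.adicCompletion ℚ) 2 := by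
        have := sub_mem hloc hsqpart
        rwa [hceq, add_sub_cancel_right] at this
      exact (E.twoDescentClass_quadraticTwist_mem_selmerLocalKer_iff (v.adicCompletion ℚ)
        (charZero_of_injective_algebraMap (algebraMap ℚ _).injective) h hsqd _ _).mp hker
    · -- `ℓ ∉ S`: good reduction of `E`, unit components
      have hℓ := (primesEquiv v).2
      have hℓ2 : (primesEquiv v : ℕ) ≠ 2 := fun h2 => hvS (h2 ▸ h2S)
      have hgoodv : E.HasGoodReductionAt v := by
        by_contra hbad
        exact hN _ hℓ hvS ((E.dvd_conductorNorm_iff v).mpr hbad)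
      exact E.twoDescentClass_mem_selmerLocalKer_of_mk_eq_intCast h v hℓ2 hgoodv _ _ ma mb hma0 hmb0 rfl rfl
        (hmadiv _ hℓ hvS) (hmbdiv _ hℓ hvS)
  · -- the real place: `d > 0`, `∏ > 0`
    have hdpos : 0 < d := by rw [hd]; exact Finset.prod_pos fun q hq => by exact_mod_cast (hQ q hq).pos
    have hpapos : 0 < ∏ i ∈ Qa, (i : ℚ) := Finset.prod_pos fun i hi => by exact_mod_cast (hQ i (hQa hi)).pos
    have hpbpos : 0 < ∏ i ∈ Qb, (i : ℚ) := Finset.prod_pos fun i hi => by exact_mod_cast (hQ i (hQb hi)).pos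
    have hloc : c ∈ selmerLocalKer (E.quadraticTwist d) w.Completion 2 := ((mem_selmerGroup_iff _ _ _).mp hc).2 w
    have hsqpart : (E.quadraticTwist d).twoDescentClass h' (Units.mk0 _ hpa0) (Units.mk0 _ hpb0) ∈
        selmerLocalKer (E.quadraticTwist d) w.Completion 2 :=
      twoDescentClass_mem_selmerLocalKer_of_isSquare (E.quadraticTwist d) h' _
        (charZero_of_injective_algebraMap (algebraMap ℚ _).injective) _ _
        (isSquare_algebraMap_completion_of_pos w hpapos) (isSquare_algebraMap_completion_of_pos w hpbpos)
    have hker : (E.quadraticTwist d).twoDescentClass h' (Units.mk0 (ma : ℚ) hma0) (Units.mk0 (mb : ℚ) hmb0) ∈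
        selmerLocalKer (E.quadraticTwist d) w.Completion 2 := by
      have := sub_mem hloc hsqpart
      rwa [hceq, add_sub_cancel_right] at this
    exact (E.twoDescentClass_quadraticTwist_mem_selmerLocalKer_iff w.Completion
      (charZero_of_injective_algebraMap (algebraMap ℚ _).injective) h (isSquare_algebraMap_completion_of_pos w hdpos)
      _ _).mp hker

end Strip

/-! ## A Selmer class of the iso-class twist is a torsion class of the base times its `Q`-support -/

section Torsion

variable (E : WeierstrassCurve ℚ) [E.IsElliptic] {e₁ e₂ e₃ : ℚ} (S Q : Finset ℕ)

/-- `𝔽₂` arithmetic: `1 + ε + x = 1 ⟹ x = ε`. [folklore] -/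
private theorem zmod2_solve₁ (ε x : ZMod 2) (h : 1 + ε + x = 1) : x = ε := by revert ε x; decide

/-- `𝔽₂` arithmetic: `ε + x = 1 ⟹ x = 1 + ε`. [folklore] -/
private theorem zmod2_solve₂ (ε x : ZMod 2) (h : ε + x = 1) : x = 1 + ε := by revert ε x; decide

/-- `𝔽₂` arithmetic: `1 + (1 + ε) = ε`. [folklore] -/
private theorem zmod2_solve₃ (ε : ZMod 2) : 1 + (1 + ε) = ε := by revert ε; decide

/-- In `ℚˣ/ℚˣ²` every class is its own inverse: `[x·t] = 1 ⟹ [x] = [t]`. [folklore] -/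
private theorem mk_eq_of_mk_mul_eq_one {x t : ℚˣ} (h : (QuotientGroup.mk (x * t) : SqUnits ℚ) = 1) :
    (QuotientGroup.mk x : SqUnits ℚ) = QuotientGroup.mk t := by
  rw [QuotientGroup.mk_mul] at h
  calc (QuotientGroup.mk x : SqUnits ℚ)
      = QuotientGroup.mk x * (QuotientGroup.mk t * QuotientGroup.mk t) := by rw [SqUnits.mul_self, mul_one]
    _ = (QuotientGroup.mk x * QuotientGroup.mk t) * QuotientGroup.mk t := by rw [mul_assoc]
    _ = QuotientGroup.mk t := by rw [h, one_mul]

/-- The components of the zero class are trivial. [cite: SilvermanAEC2009, Prop. X.1.4] -/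
private theorem mk_eq_one_of_eq_zero {W : WeierstrassCurve ℚ} [W.IsElliptic] {a₁ a₂ a₃ : ℚ}
    (h : W.toAffine.SplitTwoTorsion a₁ a₂ a₃) {c : galH1Torsion W 2} (hc : c = 0) {x : ℚˣ}
    (hx : kummerEquiv ℚ 2 (W.twoTorsionCharH1 h c) = Additive.ofMul (QuotientGroup.mk x)) :
    (QuotientGroup.mk x : SqUnits ℚ) = 1 := by
  subst hc
  rw [_root_.map_zero, _root_.map_zero] at hx
  exact Additive.ofMul.injective (hx.symm.trans ofMul_one.symm)

/-- **Every Selmer class of the iso-class twist is a torsion class of the base times an even `Q`-support class.**  In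
the setting of the module docstring (`E` of rank `0` with `Ш(E)[2] = 0`; `S ∋ 2` supports `N_E` and the root
differences; `Q ≠ ∅` an iso-class set of full-admissible primes `≡ 3 (mod 4)` of even size, disjoint from `S`), for
every `c ∈ Sel⁽²⁾(E^{(M)}/ℚ)` with components `([a],[b])` and `Q`-supports `Q_a = {i ∈ Q : v_i(a) odd}`, `Q_b`: both
supports have even size, and `[a] = [t₁ ∏_{Q_a} i]`, `[b] = [t₂ ∏_{Q_b} i]` for one of the four torsion pairs
`(t₁,t₂) = (1,1), (δ₁, e₁−e₂), (e₂−e₁, δ₂), (e₃−e₁, e₃−e₂)` of `E`.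
[cite: SilvermanAEC2009, Prop. X.1.4, Thm. X.4.2, Prop. X.4.9] [cite: MazurRubin2010, Lemma 2.10, Lemma 2.11]
[cite: Kane2013SelmerTwists, §2] -/
theorem components_eq_torsion_mul_support (h : E.toAffine.SplitTwoTorsion e₁ e₂ e₃) (hS : ∀ ℓ ∈ S, ℓ.Prime)
    (h2S : 2 ∈ S)
    (hgood : ∀ ℓ : ℕ, (hℓ : ℓ.Prime) → ℓ ∉ S → haveI : Fact ℓ.Prime := ⟨hℓ⟩;
      padicValRat ℓ (e₁ - e₂) = 0 ∧ padicValRat ℓ (e₁ - e₃) = 0 ∧ padicValRat ℓ (e₂ - e₃) = 0)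
    (hN : ∀ ℓ : ℕ, ℓ.Prime → ℓ ∉ S → ¬ ℓ ∣ E.conductorNorm ℤ)
    (hrank : E.mordellWeilRank = 0) (hsha : ∀ x ∈ E.sha, (2 : ℕ) • x = 0 → x = 0)
    (hQ : ∀ q ∈ Q, q.Prime) (hQS : ∀ q ∈ Q, q ∉ S) (hQ4 : ∀ q ∈ Q, q % 4 = 3) (hk : Even Q.card)
    {q₀ : ℕ} (hq₀ : q₀ ∈ Q)
    (hiso8 : ∀ q ∈ Q, ∀ q' ∈ Q, q % 8 = q' % 8)
    (hisoS : ∀ q ∈ Q, ∀ q' ∈ Q, ∀ ℓ ∈ S, (hℓ : ℓ.Prime) → ℓ ≠ 2 → haveI : Fact ℓ.Prime := ⟨hℓ⟩;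
      legendreSym ℓ ((q : ℤ) * q') = 1)
    (hadm : ∀ q ∈ Q, (hq : q.Prime) → haveI : Fact q.Prime := ⟨hq⟩;
      qrBit q ((e₁ - e₂) * (e₁ - e₃)) = 1 ∧ qrBit q ((e₂ - e₁) * (e₂ - e₃)) = 1)
    {ε : ZMod 2} (hε : ∀ q ∈ Q, (hq : q.Prime) → haveI : Fact q.Prime := ⟨hq⟩; qrBit q (e₂ - e₁) = ε)
    {d : ℚ} (hd : d = ∏ q ∈ Q, (q : ℚ)) [(E.quadraticTwist d).IsElliptic]
    {c : galH1Torsion (E.quadraticTwist d) 2} (hc : c ∈ selmerGroup (E.quadraticTwist d) 2) (a b : ℚˣ)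
    (ha : kummerEquiv ℚ 2 ((E.quadraticTwist d).twoTorsionCharH1 (h.quadraticTwist d) c) =
      Additive.ofMul (QuotientGroup.mk a))
    (hb : kummerEquiv ℚ 2 ((E.quadraticTwist d).twoTorsionCharH1 (h.quadraticTwist d).swap₁₂ c) =
      Additive.ofMul (QuotientGroup.mk b)) :
    Even (Q.filter (fun i => parityBit i (a : ℚ) = 1)).card ∧ Even (Q.filter (fun i => parityBit i (b : ℚ) = 1)).card ∧
    ∃ (t₁ t₂ : ℚˣ),
      (((t₁ : ℚ) = 1 ∧ (t₂ : ℚ) = 1) ∨ ((t₁ : ℚ) = (e₁ - e₂) * (e₁ - e₃) ∧ (t₂ : ℚ) = e₁ - e₂) ∨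
        ((t₁ : ℚ) = e₂ - e₁ ∧ (t₂ : ℚ) = (e₂ - e₁) * (e₂ - e₃)) ∨ ((t₁ : ℚ) = e₃ - e₁ ∧ (t₂ : ℚ) = e₃ - e₂)) ∧
      ∃ (hga : (t₁ : ℚ) * ∏ i ∈ Q.filter (fun i => parityBit i (a : ℚ) = 1), (i : ℚ) ≠ 0)
        (hgb : (t₂ : ℚ) * ∏ i ∈ Q.filter (fun i => parityBit i (b : ℚ) = 1), (i : ℚ) ≠ 0),
        (QuotientGroup.mk a : SqUnits ℚ) = QuotientGroup.mk (Units.mk0 _ hga) ∧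
          (QuotientGroup.mk b : SqUnits ℚ) = QuotientGroup.mk (Units.mk0 _ hgb) := by
  haveI hq₀F : Fact q₀.Prime := ⟨hQ q₀ hq₀⟩
  have hQ0 : ∀ q ∈ Q, (q : ℚ) ≠ 0 := fun q hq => by exact_mod_cast (hQ q hq).ne_zero
  -- part II: kernels and evenness
  obtain ⟨ma, hma0, hmadiv, -, ⟨hga, hmka⟩, -, -⟩ := exists_intKernel_of_mem_selmerGroup_twist_isoClass E S Q h hS
    (fun ℓ hℓ hℓS => ⟨(hgood ℓ hℓ hℓS).1, (hgood ℓ hℓ hℓS).2.1⟩) hQ hQS hQ4 hiso8 hisoS hd hc a ha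
  obtain ⟨mb, hmb0, hmbdiv, -, ⟨hgb, hmkb⟩, -, -⟩ := exists_intKernel_of_mem_selmerGroup_twist_isoClass E S Q h.swap₁₂
    hS (fun ℓ hℓ hℓS => ⟨by rw [← neg_sub, padicValRat.neg]; exact (hgood ℓ hℓ hℓS).1, (hgood ℓ hℓ hℓS).2.2⟩)
    hQ hQS hQ4 hiso8 hisoS hd hc b hb
  obtain ⟨⟨hevena, hevenb⟩, -⟩ := rows_of_mem_selmerGroup_twist_isoClass E S Q h hS hgood hQ hQS hQ4 hk hiso8 hisoS hadm
    hε hd hc a b ha hb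
  rw [sum_parityBit_eq_card, ZMod.natCast_eq_zero_iff_even] at hevena hevenb
  set Qa := Q.filter (fun i => parityBit i (a : ℚ) = 1) with hQa
  set Qb := Q.filter (fun i => parityBit i (b : ℚ) = 1) with hQb
  have hQaQ : Qa ⊆ Q := Finset.filter_subset _ _
  have hQbQ : Qb ⊆ Q := Finset.filter_subset _ _
  have hpa0 : ∏ i ∈ Qa, (i : ℚ) ≠ 0 := Finset.prod_ne_zero_iff.mpr fun i hi => hQ0 i (hQaQ hi)
  have hpb0 : ∏ i ∈ Qb, (i : ℚ) ≠ 0 := Finset.prod_ne_zero_iff.mpr fun i hi => hQ0 i (hQbQ hi)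
  -- part III: the stripped class `y = c_E(m_a, m_b)` is Selmer
  have hy : E.twoDescentClass h (Units.mk0 (ma : ℚ) hma0) (Units.mk0 (mb : ℚ) hmb0) ∈ E.selmerGroup 2 :=
    twoDescentClass_kernel_mem_selmerGroup E S Q h h2S hN hQ hQS hQ4 hk hiso8 hisoS hd hc a b ha hb hQaQ hQbQ
      hevena hevenb hma0 hmb0 hmadiv hmbdiv hga hgb hmka hmkb
  refine ⟨hevena, hevenb, ?_⟩
  -- residue bits at `q₀` and the torsion class with the same bits
  have he12 : e₁ - e₂ ≠ 0 := sub_ne_zero.mpr h.ne₁₂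
  have he21 : e₂ - e₁ ≠ 0 := sub_ne_zero.mpr h.ne₁₂.symm
  have he13 : e₁ - e₃ ≠ 0 := sub_ne_zero.mpr h.ne₁₃
  have he31 : e₃ - e₁ ≠ 0 := sub_ne_zero.mpr h.ne₁₃.symm
  have he23 : e₂ - e₃ ≠ 0 := sub_ne_zero.mpr h.ne₂₃
  have he32 : e₃ - e₂ ≠ 0 := sub_ne_zero.mpr h.ne₂₃.symm
  have hm1 : qrBit q₀ (-1 : ℚ) = 1 := qrBit_neg_one_eq_one_of_emod_four (hQ4 q₀ hq₀)
  obtain ⟨hδ₁, hδ₂⟩ := hadm q₀ hq₀ hq₀F.out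
  have hε₀ := hε q₀ hq₀ hq₀F.out
  -- residue bits of the torsion values at `q₀`
  have hq12 : qrBit q₀ (e₁ - e₂) = 1 + ε := by rw [← neg_sub, qrBit_neg (p := q₀) he21, hm1, hε₀]
  have hq31 : qrBit q₀ (e₃ - e₁) = 1 + ε := by
    -- `δ₁ = (e₁−e₂)(e₁−e₃)`: `1 = (1+ε) + qr(e₁−e₃)`, and `qr(e₃−e₁) = 1 + qr(e₁−e₃)`
    have h1 : qrBit q₀ (e₁ - e₃) = ε := by
      have := hδ₁; rw [qrBit_mul q₀ he12 he13, hq12] at this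
      exact zmod2_solve₁ ε _ this
    rw [← neg_sub, qrBit_neg (p := q₀) he13, hm1, h1]
  have hq32 : qrBit q₀ (e₃ - e₂) = ε := by
    have h1 : qrBit q₀ (e₂ - e₃) = 1 + ε := by
      have := hδ₂; rw [qrBit_mul q₀ he21 he23, hε₀] at this
      exact zmod2_solve₂ ε _ this
    rw [← neg_sub, qrBit_neg (p := q₀) he23, hm1, h1, zmod2_solve₃]
  -- generic step: a Selmer torsion class `t` whose bits at `q₀` match those of `y` forces `[m] = [t]`
  have key : ∀ (t₁ t₂ : ℚˣ), E.twoDescentClass h t₁ t₂ ∈ E.selmerGroup 2 →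
      qrBit q₀ (t₁ : ℚ) = qrBit q₀ (ma : ℚ) → qrBit q₀ (t₂ : ℚ) = qrBit q₀ (mb : ℚ) →
      (QuotientGroup.mk (Units.mk0 (ma : ℚ) hma0) : SqUnits ℚ) = QuotientGroup.mk t₁ ∧
        (QuotientGroup.mk (Units.mk0 (mb : ℚ) hmb0) : SqUnits ℚ) = QuotientGroup.mk t₂ := by
    intro t₁ t₂ ht hr₁ hr₂
    have hsum := add_mem hy ht
    rw [← twoDescentClass_mul] at hsum
    have hz := E.eq_zero_of_mem_selmerGroup_of_qrBit_eq_zero h hrank hsha hm1 hδ₁ hδ₂ hsum _ _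
      (E.kummerEquiv_twoTorsionCharH1_twoDescentClass h _ _) (E.kummerEquiv_twoTorsionCharH1_swap_twoDescentClass h _ _)
      (by rw [Units.val_mul, Units.val_mk0, qrBit_mul q₀ hma0 t₁.ne_zero, hr₁, CharTwo.add_self_eq_zero])
      (by rw [Units.val_mul, Units.val_mk0, qrBit_mul q₀ hmb0 t₂.ne_zero, hr₂, CharTwo.add_self_eq_zero])
    exact ⟨mk_eq_of_mk_mul_eq_one (mk_eq_one_of_eq_zero h hz (E.kummerEquiv_twoTorsionCharH1_twoDescentClass h _ _)),
      mk_eq_of_mk_mul_eq_one (mk_eq_one_of_eq_zero h.swap₁₂ hz (E.kummerEquiv_twoTorsionCharH1_swap_twoDescentClass h _ _))⟩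
  -- conclusion template
  have finish : ∀ (t₁ t₂ : ℚˣ),
      (((t₁ : ℚ) = 1 ∧ (t₂ : ℚ) = 1) ∨ ((t₁ : ℚ) = (e₁ - e₂) * (e₁ - e₃) ∧ (t₂ : ℚ) = e₁ - e₂) ∨
        ((t₁ : ℚ) = e₂ - e₁ ∧ (t₂ : ℚ) = (e₂ - e₁) * (e₂ - e₃)) ∨ ((t₁ : ℚ) = e₃ - e₁ ∧ (t₂ : ℚ) = e₃ - e₂)) →
      (QuotientGroup.mk (Units.mk0 (ma : ℚ) hma0) : SqUnits ℚ) = QuotientGroup.mk t₁ →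
      (QuotientGroup.mk (Units.mk0 (mb : ℚ) hmb0) : SqUnits ℚ) = QuotientGroup.mk t₂ →
      ∃ (t₁ t₂ : ℚˣ),
        (((t₁ : ℚ) = 1 ∧ (t₂ : ℚ) = 1) ∨ ((t₁ : ℚ) = (e₁ - e₂) * (e₁ - e₃) ∧ (t₂ : ℚ) = e₁ - e₂) ∨
          ((t₁ : ℚ) = e₂ - e₁ ∧ (t₂ : ℚ) = (e₂ - e₁) * (e₂ - e₃)) ∨ ((t₁ : ℚ) = e₃ - e₁ ∧ (t₂ : ℚ) = e₃ - e₂)) ∧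
        ∃ (hga : (t₁ : ℚ) * ∏ i ∈ Qa, (i : ℚ) ≠ 0) (hgb : (t₂ : ℚ) * ∏ i ∈ Qb, (i : ℚ) ≠ 0),
          (QuotientGroup.mk a : SqUnits ℚ) = QuotientGroup.mk (Units.mk0 _ hga) ∧
            (QuotientGroup.mk b : SqUnits ℚ) = QuotientGroup.mk (Units.mk0 _ hgb) := by
    intro t₁ t₂ htor h₁ h₂
    refine ⟨t₁, t₂, htor, mul_ne_zero t₁.ne_zero hpa0, mul_ne_zero t₂.ne_zero hpb0, ?_, ?_⟩
    · rw [hmka]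
      have e1 : (Units.mk0 _ hga : ℚˣ) = Units.mk0 (ma : ℚ) hma0 * Units.mk0 _ hpa0 := Units.ext (by simp)
      have e2 : (Units.mk0 _ (mul_ne_zero t₁.ne_zero hpa0) : ℚˣ) = t₁ * Units.mk0 _ hpa0 := Units.ext (by simp)
      rw [e1, e2, QuotientGroup.mk_mul, QuotientGroup.mk_mul, h₁]
    · rw [hmkb]
      have e1 : (Units.mk0 _ hgb : ℚˣ) = Units.mk0 (mb : ℚ) hmb0 * Units.mk0 _ hpb0 := Units.ext (by simp)
      have e2 : (Units.mk0 _ (mul_ne_zero t₂.ne_zero hpb0) : ℚˣ) = t₂ * Units.mk0 _ hpb0 := Units.ext (by simp)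
      rw [e1, e2, QuotientGroup.mk_mul, QuotientGroup.mk_mul, h₂]
  -- the trivial class `c(1,1) = 0` is Selmer
  have hO : E.twoDescentClass h 1 1 ∈ E.selmerGroup 2 := by
    rw [← E.eq_twoDescentClass_of_kummerEquiv_eq h 1 1 (c := 0)
      (by rw [_root_.map_zero, _root_.map_zero, QuotientGroup.mk_one, ofMul_one])
      (by rw [_root_.map_zero, _root_.map_zero, QuotientGroup.mk_one, ofMul_one])]
    exact zero_mem _
  -- the four cases on the bits `(qr_{q₀}(m_a), qr_{q₀}(m_b))`
  have hz2 : ∀ x : ZMod 2, x = 0 ∨ x = 1 := by decide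
  rcases hz2 (qrBit q₀ (ma : ℚ)) with ra | ra <;> rcases hz2 (qrBit q₀ (mb : ℚ)) with rb | rb <;>
    rcases hz2 ε with hε0 | hε0 <;> simp only [hε0] at hq12 hq31 hq32 hε₀
  -- (0,0): `O`
  · obtain ⟨h₁, h₂⟩ := key 1 1 hO (by rw [Units.val_one, qrBit_one, ra]) (by rw [Units.val_one, qrBit_one, rb])
    exact finish 1 1 (Or.inl ⟨rfl, rfl⟩) h₁ h₂
  · obtain ⟨h₁, h₂⟩ := key 1 1 hO (by rw [Units.val_one, qrBit_one, ra]) (by rw [Units.val_one, qrBit_one, rb])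
    exact finish 1 1 (Or.inl ⟨rfl, rfl⟩) h₁ h₂
  -- (0,1): `ε = 0`: `T₂ ↦ (ε,1) = (0,1)`; `ε = 1`: `T₃ ↦ (1+ε, ε) = (0,1)`
  · obtain ⟨h₁, h₂⟩ := key (Units.mk0 _ he21) (Units.mk0 _ (mul_ne_zero he21 he23))
        (twoDescentClass_mem_selmerGroup_T₂ E h _ _ rfl rfl) (by rw [Units.val_mk0, hε₀, ra])
        (by rw [Units.val_mk0, hδ₂, rb])
    exact finish _ _ (Or.inr (Or.inr (Or.inl ⟨rfl, rfl⟩))) h₁ h₂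
  · obtain ⟨h₁, h₂⟩ := key (Units.mk0 _ he31) (Units.mk0 _ he32)
        (twoDescentClass_mem_selmerGroup_T₃ E h _ _ rfl rfl) (by rw [Units.val_mk0, hq31, ra]; decide)
        (by rw [Units.val_mk0, hq32, rb])
    exact finish _ _ (Or.inr (Or.inr (Or.inr ⟨rfl, rfl⟩))) h₁ h₂
  -- (1,0): `ε = 0`: `T₃ ↦ (1,0)`; `ε = 1`: `T₁ ↦ (1, 1+ε) = (1,0)`
  · obtain ⟨h₁, h₂⟩ := key (Units.mk0 _ he31) (Units.mk0 _ he32)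
        (twoDescentClass_mem_selmerGroup_T₃ E h _ _ rfl rfl) (by rw [Units.val_mk0, hq31, ra]; decide)
        (by rw [Units.val_mk0, hq32, rb])
    exact finish _ _ (Or.inr (Or.inr (Or.inr ⟨rfl, rfl⟩))) h₁ h₂
  · obtain ⟨h₁, h₂⟩ := key (Units.mk0 _ (mul_ne_zero he12 he13)) (Units.mk0 _ he12)
        (twoDescentClass_mem_selmerGroup_T₁ E h _ _ rfl rfl) (by rw [Units.val_mk0, hδ₁, ra])
        (by rw [Units.val_mk0, hq12, rb]; decide)
    exact finish _ _ (Or.inr (Or.inl ⟨rfl, rfl⟩)) h₁ h₂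
  -- (1,1): `ε = 0`: `T₁ ↦ (1, 1)`; `ε = 1`: `T₂ ↦ (ε, 1) = (1,1)`
  · obtain ⟨h₁, h₂⟩ := key (Units.mk0 _ (mul_ne_zero he12 he13)) (Units.mk0 _ he12)
        (twoDescentClass_mem_selmerGroup_T₁ E h _ _ rfl rfl) (by rw [Units.val_mk0, hδ₁, ra])
        (by rw [Units.val_mk0, hq12, rb]; decide)
    exact finish _ _ (Or.inr (Or.inl ⟨rfl, rfl⟩)) h₁ h₂
  · obtain ⟨h₁, h₂⟩ := key (Units.mk0 _ he21) (Units.mk0 _ (mul_ne_zero he21 he23))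
        (twoDescentClass_mem_selmerGroup_T₂ E h _ _ rfl rfl) (by rw [Units.val_mk0, hε₀, ra])
        (by rw [Units.val_mk0, hδ₂, rb])
    exact finish _ _ (Or.inr (Or.inr (Or.inl ⟨rfl, rfl⟩))) h₁ h₂

end Torsion

end Summit.BirchSwinnertonDyer.BirchSwinnertonDyer.Theorems.GenusKolyvaginAtTwo.TorsionCellSEL

end
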